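import Summits.BirchSwinnertonDyer.Rank1Residual.Additive.XGordRankZeroOneCyclotomicThreeLowerFacts
import Summits.BirchSwinnertonDyer.Rank1Residual.Additive.XGordRankZeroOneCyclotomicThreeLowerNoLocal
import Summits.BirchSwinnertonDyer.Rank1Residual.Additive.XGordRankZeroOneCyclotomicThreeNoMilneFacts
import HarnessLib

/-!
# The LOWER twin of line V17 AND its two-sided consequences (X4, `p = 3`, ranks `(0,1)`, over
# `K = ℚ(ζ₃)`) from named facts + the ONE residual input (⊇/K) + the certificate, with Milne's A73
# PROVED AWAY on BOTH halves and NO population hypothesis: `Typed.MissingLowerBoundAt W 3`,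
# `BSD(W,3) ↔ BSD(V,3)`, `BSD(W,3) ∧ BSD(V,3)` and the class forms on N11's (G-ord)@3 rows with
# `surj(3) ∧ ram(3)` whose twist has analytic rank ONE (cell `b2b-bsdres`, team n1011, seat p16 GEN 11;
# lead R5-87 (e) (W1)/(W2) = additive-p4 GEN 23 words; rows T-N11-GK3LOW × T-MIL-CAN; Facts-level
# consumer of FILE 6 `XGordRankZeroOneCyclotomicThreeLowerNoLocal` and of `XGordRankZeroOneCyclotomicThreeNoMilneFacts`)

HONEST FRAMING (cell `b2b-bsdres`, run/shared/lean/b2b/bsd-rank1-residual/, verbatim in every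
file): the goal of the cell is to DELETE the COMBINATION-SHAPED residual classes of the
Birch–Swinnerton-Dyer formula for ALL analytic-rank `≤ 1` elliptic curves over `ℚ` — "full BSD
formula for every rank `≤ 1` curve in class `C`" assembled STRICTLY from published theorems — so
that the rank-`≤ 1` remainder becomes exactly the CONSTRUCTION-SHAPED classes, which are TYPED
(missing-input `Prop`s), NOT attempted. This is not "finishing BSD". Team n1011 (N10 / N11), seat
p16: research route; the labels of X4 / X10 and the N10 / N11 marks are UNCHANGED by this file;
nothing is booked here (the referee rules on bookings).

Theorems only (no `def`, no `sorry`, no new named fact). This is the gen-2 Facts file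
`XGordRankZeroOneCyclotomicThreeLowerFacts.lean` (p16) with the Milne binder `hMilne`
(A73 `Milne1972.bsdQuotient_baseChange_quadratic_anyModel`) DELETED from EVERY theorem and NOTHING
added (in particular NO `Squarefree N_V`, unlike GEN 9's S₁ twin `…LowerSemistableFacts`): each theorem is
re-issued under its name with the suffix `_noMilne`, every other binder and every proof line
byte-identical; the LOWER core call goes to FILE 6
`XGordRankZeroOneCyclotomicThreeLower.exists_padicVal_shaAn_add_le_noLocal` (p316606) and the UPPER half
(line V17, Kato ⊆ over `K`) to `X4GordRankZeroOneCyclotomicThree.exists_padicVal_shaOrder_add_le_of_surj_of_ram_noMilne`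
(`XGordRankZeroOneCyclotomicThreeNoMilneFacts.lean`); in both, what the gen-2 cores read from A73 —
`Ш(V_K)` finite and the any-rank `3`-adic card identity — are the THEOREMS `shaFinite_baseChange_of_twist`
and T-MIL-CAN FILE 4 `padicVal_card_identity_baseChange_anyRank_of_natAbs_discr_eq` (`|d_K| = 3`, `V` good
at `3`: the per-place fibre identities (T) at EVERY place — n1011-p01's T-MIL-3 H-5a with rows T-MIL-B2 /
T-A233 inside). The remaining inputs are EXACTLY: (⊇/K) = `hLowK` (two-branch main-conjecture
containment for `V` over `ℚ(√−3)`; NOT in print — PLAN §1.2 II.3; no `def`, no fact), Kato Thm. 17.4 (3)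
over `K` (`hKato`), Greenberg p. 110 / Schneider (`hS1`), Perrin-Riou (`hPR`), Mazur–Tate σ (`hMT`),
modularity (`hmod`, `hmodD`), GZK (`hGZK`), Yan–Zhu 2026 Thm. 4.15 (`hYZ`, only in the `bsdp` ENDs), and
per row the census bits `surj(3) ∧ ram(3)` of `W` and the certificate `[T¹]L₃(f_V, α) ≠ 0` (`hcert`).
Results: the gen-2 file's list, each name with `_noMilne` (`…exists_padicVal_shaAn_add_le_of_surj_of_ram_noMilne`,
`…padicVal_shaOrder_add_eq…`, `…missingLowerBoundAt…` ×2, `…bsdp_iff_bsdp_twist…`, `…bsdp_of_surj_of_ram…`,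
class forms `ClassX4Gord.missingLowerBoundAt_three_rankZero_twistRankOne_of_lowerK_of_surj_of_ram_noMilne`,
`ClassX4Gord.bsdp_three_rankZero_twistRankOne_of_lowerK_of_surj_of_ram_noMilne`).
Nothing booked; X4 / N11 labels unchanged; no mark moves.
-/

noncomputable section

open scoped Classical MatrixGroups ModularForm

open CongruenceSubgroup WeierstrassCurve NumberField IsDedekindDomain
  Literature.NumberTheory.EllipticCurves Literature.NumberTheory.EllipticCurves.ModularForms
  Literature.NumberTheory.EllipticCurves.Rank1Residual
  Literature.NumberTheory.EllipticCurves.Rank1Residual.Typed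
  Literature.NumberTheory.GaloisRepresentations

namespace Summit.BirchSwinnertonDyer.Rank1Residual.Additive

section Facts

variable (V : WeierstrassCurve ℚ) [V.IsElliptic] [V.IsGloballyMinimal]
  (W : WeierstrassCurve ℚ) [W.IsElliptic] [W.IsGloballyMinimal]

/- The ONE residual input (⊇/K) for `V` over `K = CyclotomicField 3 ℚ` (module docstring); a section
hypothesis shared by every theorem of this section. -/
variable
    (hLowK : ∀ {κ : ZpExtension (CyclotomicField 3 ℚ) 3}
      {γ : Field.absoluteGaloisGroup (CyclotomicField 3 ℚ)} {N : ℕ} [NeZero N]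
      {f : CuspForm (Gamma0 N) 2},
      κ.IsCyclotomic → κ.IsTopGenerator γ →
      (∃ ζ : ℤ_[3]ˣ, IsOfFinOrder ζ ∧
        ((GaloisRep.cyclotomicCharacter (CyclotomicField 3 ℚ) 3 γ * ζ : ℤ_[3]ˣ) : ℤ_[3]) =
          (cyclotomicGenerator 3 : ℤ_[3])) →
      IsNewformOf V f →
      ∀ (D : (V.baseChange (CyclotomicField 3 ℚ)).SelmerDualData κ γ) (ϖ ϖ' : ℚ),
        (ϖ : ℝ) * V.realPeriodRat = plusPeriod f →
        (ϖ' : ℝ) * V.imaginaryPeriodRat = minusPeriod f →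
        ∀ g ∈ D.charIdeal, ∃ h : IwasawaAlgebra 3,
          iwasawaToPowerSeries 3 g =
            iwasawaToPowerSeries 3 h *
              (PowerSeries.C ((ϖ : ℚ_[3]) * (ϖ' : ℚ_[3])) *
                (padicLFunction f ((unitRoot V 3 : ℤ_[3]) : ℚ_[3]) *
                  padicLFunctionMinusBranch f ((unitRoot V 3 : ℤ_[3]) : ℚ_[3]) 1)))

include hLowK

/-- **LOWER twin of line V17 for X4, from named facts + (⊇/K) + the certificate, NO Milne.** For `V/ℚ` globally
minimal, good ordinary at `3`, of analytic rank `1`, `W = C • V^{(−3)}` globally minimal ADDITIVE at `3` of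
analytic rank `0` with `surj(3) ∧ ram(3)` (so `ρ_{V,3^∞}` is onto, `forall_surj_pow_of_twist_pStar_of_surj_of_ram`),
and the certificate `[T¹]L₃(f,α) ≠ 0` for the newform(s) of `V`: `#Ш_an(V) = q_V`, `#Ш_an(W) = q_W` with
**`ord₃ q_V + ord₃ q_W ≤ ord₃ #Ш(V) + ord₃ #Ш(W)`**, granted (⊇/K) (`hLowK`) and EXACTLY the named facts
of line V17: Kato Thm. 17.4 (3) over `ℚ(ζ₃)` (`hKato`, torsion clause), Greenberg p. 110 / Schneider over
`ℚ(ζ₃)` (`hS1`), Perrin-Riou 1987 (`hPR`), the Mazur–Tate sigma function (`hMT`), modularity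
(`hmod`, `hmodD`), GZK (`hGZK`) — and NO Milne: the core is p16 GEN 10's FILE 6
`XGordRankZeroOneCyclotomicThreeLower.exists_padicVal_shaAn_add_le_noLocal` (`Ш(V_K)` finite and the any-rank
`3`-adic card identity are THEOREMS, T-MIL-CAN FILE 4). Binder diff vs the gen-2 theorem: {`hMilne`} ↦ ∅.
[cite: GreenbergLNM1716, §4 p. 110] [cite: PerrinRiou1987, §1.4 Cor. 1.8] [cite: Kato2004Asterisque, Thm. 17.4 (3) (p. 273)]
[cite: Milne1972ArithmeticAV, §1 Thm. 1 and §2 (through DokchitserDokchitserAnnals2010, §2.1, proof of Thm. 8)] -/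
theorem XGordRankZeroOneCyclotomicThreeLower.exists_padicVal_shaAn_add_le_of_surj_of_ram_noMilne
    (hKato : Kato2004.charIdeal_dvd_padicLFunction_cyclotomicThree_of_surjective)
    (hS1 : Greenberg1999.schneider_charCoeff_rankOne_quadraticBaseChange)
    (hPR : perrinRiou_rankOne_leadingTerms_odd) (hMT : mazur_tate_sigma_exists_odd)
    (hGZK : rank_eq_analyticRank_of_analyticRank_le_one) (hmod : hasEntireLFunction_rat)
    (hmodD : nonempty_modularParametrizationData)
    (C : VariableChange ℚ) (hC : C • V.quadraticTwist (-(3 : ℚ)) = W)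
    (hord : IsOrdinaryAt V 3) (hsurj : Surj W 3) (hram : Ram W 3) (hadd : Addv W 3)
    (hrV : V.analyticRank = 1) (hrW : W.analyticRank = 0)
    (hcert : ∀ {N : ℕ} [NeZero N] (f : CuspForm (Gamma0 N) 2), IsNewformOf V f →
      PowerSeries.coeff 1 (padicLFunction f ((unitRoot V 3 : ℤ_[3]) : ℚ_[3])) ≠ 0) :
    ∃ qV qW : ℚ, shaAn V = (qV : ℂ) ∧ shaAn W = (qW : ℂ) ∧
      padicValRat 3 qV + padicValRat 3 qW ≤ (padicValNat 3 V.shaOrder : ℤ) + padicValNat 3 W.shaOrder := by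
  haveI : IsCyclotomicExtension {3} ℚ (CyclotomicField 3 ℚ) := CyclotomicField.isCyclotomicExtension 3 ℚ
  set K := CyclotomicField 3 ℚ
  haveI : NeZero (V.conductorNorm ℤ) := ⟨(V.conductorNorm_pos_holds).ne'⟩
  obtain ⟨Dm⟩ := hmodD V
  have hf : IsNewformOf V Dm.f := Dm.isNewformOf
  obtain ⟨ϖ, -, hϖ, -⟩ := Dm.exists_rat_mul_realPeriodRat_eq_plusPeriod
  obtain ⟨ϖ', -, hϖ'⟩ := exists_rat_mul_imaginaryPeriodRat_eq_minusPeriod Dm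
  obtain ⟨Dh, hDh⟩ := exists_isCanonical_of_odd hMT V 3 (by norm_num) hord.1 hord.2
  have hC' : C • V.quadraticTwist (((-((3 : ℕ) : ℤ)) : ℤ) : ℚ) = W := by push_cast; exact hC
  have hsurjV : ∀ n : ℕ, V.HasSurjectiveModNGaloisRep (3 ^ n : ℕ) :=
    forall_surj_pow_of_twist_pStar_of_surj_of_ram 3 V (k := -1) (by norm_num) (Or.inr rfl) C hC' hsurj hram
  haveI : (V.baseChange K).IsElliptic := by rw [baseChange]; infer_instance
  refine XGordRankZeroOneCyclotomicThreeLower.exists_padicVal_shaAn_add_le_noLocal K V W hPR hGZK hmod C hC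
    hord hadd hrV hrW hf ϖ ϖ' hϖ hϖ' Dh hDh (hcert Dm.f hf) (fun κ γ hκ hγ hγ' D ↦ ?_)
    (fun κ γ hκ hγ hγ' D g hg ↦ hLowK hκ hγ hγ' hf D ϖ ϖ' hϖ hϖ' g hg)
    (XGordRankZeroOneCyclotomicThree.schneiderK_of_fact K V hS1 hord)
  exact (hKato V K (V.baseChange K) hord hsurjV ⟨1, one_smul _ _⟩ hκ hγ hγ' hf D ϖ ϖ' hϖ hϖ').1

/-- **The two-sided main conjecture over `K` gives the EQUALITY of sums in ranks `(0,1)`.** The UPPER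
line V17 (`X4GordRankZeroOneCyclotomicThree.exists_padicVal_shaOrder_add_le_of_surj_of_ram_noMilne`, Kato ⊆ over
`K`, a THEOREM modulo named facts + `hcert`) and the LOWER twin (⊇/K) together:
**`ord₃ #Ш(V) + ord₃ #Ш(W) = ord₃ #Ш_an(V) + ord₃ #Ш_an(W)`**.
[cite: Kato2004Asterisque, Thm. 17.4 (3) (p. 273)] [cite: GreenbergLNM1716, §4 p. 110] -/
theorem XGordRankZeroOneCyclotomicThreeLower.padicVal_shaOrder_add_eq_of_surj_of_ram_noMilne
    (hKato : Kato2004.charIdeal_dvd_padicLFunction_cyclotomicThree_of_surjective)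
    (hS1 : Greenberg1999.schneider_charCoeff_rankOne_quadraticBaseChange)
    (hPR : perrinRiou_rankOne_leadingTerms_odd) (hMT : mazur_tate_sigma_exists_odd)
    (hGZK : rank_eq_analyticRank_of_analyticRank_le_one) (hmod : hasEntireLFunction_rat)
    (hmodD : nonempty_modularParametrizationData)
    (C : VariableChange ℚ) (hC : C • V.quadraticTwist (-(3 : ℚ)) = W)
    (hord : IsOrdinaryAt V 3) (hsurj : Surj W 3) (hram : Ram W 3) (hadd : Addv W 3)
    (hrV : V.analyticRank = 1) (hrW : W.analyticRank = 0)
    (hcert : ∀ {N : ℕ} [NeZero N] (f : CuspForm (Gamma0 N) 2), IsNewformOf V f →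
      PowerSeries.coeff 1 (padicLFunction f ((unitRoot V 3 : ℤ_[3]) : ℚ_[3])) ≠ 0) :
    ∃ qV qW : ℚ, shaAn V = (qV : ℂ) ∧ shaAn W = (qW : ℂ) ∧
      (padicValNat 3 V.shaOrder : ℤ) + padicValNat 3 W.shaOrder = padicValRat 3 qV + padicValRat 3 qW := by
  obtain ⟨qV, qW, hqV, hqW, hle⟩ :=
    X4GordRankZeroOneCyclotomicThree.exists_padicVal_shaOrder_add_le_of_surj_of_ram_noMilne V W hKato hS1 hPR hMT
      hGZK hmod hmodD C hC hord hsurj hram hadd hrV hrW hcert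
  obtain ⟨qV', qW', hqV', hqW', hge⟩ :=
    XGordRankZeroOneCyclotomicThreeLower.exists_padicVal_shaAn_add_le_of_surj_of_ram_noMilne V W hLowK hKato hS1 hPR hMT hGZK hmod hmodD C hC hord hsurj hram hadd hrV hrW hcert
  have hqq : qV' = qV := by exact_mod_cast hqV'.symm.trans hqV
  have hqq' : qW' = qW := by exact_mod_cast hqW'.symm.trans hqW
  subst hqq hqq'
  exact ⟨qV', qW', hqV, hqW, le_antisymm hle hge⟩

/-- **`Typed.MissingLowerBoundAt W 3` for the ADDITIVE rank-`0` curve from (⊇/K) and the UPPER half of its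
good ordinary rank-ONE twist** (X4 ∧ (G-ord, `e = 2`)@3 ∧ `surj ∧ ram`, anomalous rows included).
[cite: GreenbergLNM1716, §4 p. 110] [cite: Miller2011LMS, Def. 1.1] -/
theorem XGordRankZeroOneCyclotomicThreeLower.missingLowerBoundAt_of_missingUpperBoundAt_twist_of_surj_of_ram_noMilne
    (hKato : Kato2004.charIdeal_dvd_padicLFunction_cyclotomicThree_of_surjective)
    (hS1 : Greenberg1999.schneider_charCoeff_rankOne_quadraticBaseChange)
    (hPR : perrinRiou_rankOne_leadingTerms_odd) (hMT : mazur_tate_sigma_exists_odd)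
    (hGZK : rank_eq_analyticRank_of_analyticRank_le_one) (hmod : hasEntireLFunction_rat)
    (hmodD : nonempty_modularParametrizationData)
    (C : VariableChange ℚ) (hC : C • V.quadraticTwist (-(3 : ℚ)) = W)
    (hord : IsOrdinaryAt V 3) (hsurj : Surj W 3) (hram : Ram W 3) (hadd : Addv W 3)
    (hrV : V.analyticRank = 1) (hrW : W.analyticRank = 0)
    (hcert : ∀ {N : ℕ} [NeZero N] (f : CuspForm (Gamma0 N) 2), IsNewformOf V f →
      PowerSeries.coeff 1 (padicLFunction f ((unitRoot V 3 : ℤ_[3]) : ℚ_[3])) ≠ 0)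
    (huV : MissingUpperBoundAt V 3) : MissingLowerBoundAt W 3 := by
  obtain ⟨qV, qW, hqV, hqW, hge⟩ :=
    XGordRankZeroOneCyclotomicThreeLower.exists_padicVal_shaAn_add_le_of_surj_of_ram_noMilne V W hLowK hKato hS1 hPR hMT hGZK hmod hmodD C hC hord hsurj hram hadd hrV hrW hcert
  obtain ⟨qV', hqV', hu⟩ := huV
  have hqq : qV' = qV := by exact_mod_cast hqV'.symm.trans hqV
  subst hqq
  exact ⟨qW, hqW, by linarith⟩

/-- **Symmetrically: `Typed.MissingLowerBoundAt V 3` for the rank-ONE good ordinary curve `V` from (⊇/K)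
and the UPPER half of its additive rank-`0` twist `W`.** [cite: GreenbergLNM1716, §4 p. 110]
[cite: Miller2011LMS, Def. 1.1] -/
theorem XGordRankZeroOneCyclotomicThreeLower.missingLowerBoundAt_twist_of_missingUpperBoundAt_of_surj_of_ram_noMilne
    (hKato : Kato2004.charIdeal_dvd_padicLFunction_cyclotomicThree_of_surjective)
    (hS1 : Greenberg1999.schneider_charCoeff_rankOne_quadraticBaseChange)
    (hPR : perrinRiou_rankOne_leadingTerms_odd) (hMT : mazur_tate_sigma_exists_odd)
    (hGZK : rank_eq_analyticRank_of_analyticRank_le_one) (hmod : hasEntireLFunction_rat)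
    (hmodD : nonempty_modularParametrizationData)
    (C : VariableChange ℚ) (hC : C • V.quadraticTwist (-(3 : ℚ)) = W)
    (hord : IsOrdinaryAt V 3) (hsurj : Surj W 3) (hram : Ram W 3) (hadd : Addv W 3)
    (hrV : V.analyticRank = 1) (hrW : W.analyticRank = 0)
    (hcert : ∀ {N : ℕ} [NeZero N] (f : CuspForm (Gamma0 N) 2), IsNewformOf V f →
      PowerSeries.coeff 1 (padicLFunction f ((unitRoot V 3 : ℤ_[3]) : ℚ_[3])) ≠ 0)
    (huW : MissingUpperBoundAt W 3) : MissingLowerBoundAt V 3 := by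
  obtain ⟨qV, qW, hqV, hqW, hge⟩ :=
    XGordRankZeroOneCyclotomicThreeLower.exists_padicVal_shaAn_add_le_of_surj_of_ram_noMilne V W hLowK hKato hS1 hPR hMT hGZK hmod hmodD C hC hord hsurj hram hadd hrV hrW hcert
  obtain ⟨qW', hqW', hu⟩ := huW
  have hqq : qW' = qW := by exact_mod_cast hqW'.symm.trans hqW
  subst hqq
  exact ⟨qV, hqV, by linarith⟩

/-- **Λ-adic twist transport at `3`, ranks `(0,1)`: `BSD(W,3) ↔ BSD(V,3)` under the two-sided main
conjecture over `K = ℚ(ζ₃)`** — the BSD defects of the additive rank-`0` curve `W` and of its good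
ordinary rank-ONE twist `V` are opposite (`…padicVal_shaOrder_add_eq_of_surj_of_ram`), so one vanishes
iff the other does. [cite: Kato2004Asterisque, Thm. 17.4 (3) (p. 273)] [cite: Miller2011LMS, §1 and Def. 1.1] -/
theorem XGordRankZeroOneCyclotomicThreeLower.bsdp_iff_bsdp_twist_of_surj_of_ram_noMilne
    (hKato : Kato2004.charIdeal_dvd_padicLFunction_cyclotomicThree_of_surjective)
    (hS1 : Greenberg1999.schneider_charCoeff_rankOne_quadraticBaseChange)
    (hPR : perrinRiou_rankOne_leadingTerms_odd) (hMT : mazur_tate_sigma_exists_odd)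
    (hGZK : rank_eq_analyticRank_of_analyticRank_le_one) (hmod : hasEntireLFunction_rat)
    (hmodD : nonempty_modularParametrizationData)
    (C : VariableChange ℚ) (hC : C • V.quadraticTwist (-(3 : ℚ)) = W)
    (hord : IsOrdinaryAt V 3) (hsurj : Surj W 3) (hram : Ram W 3) (hadd : Addv W 3)
    (hrV : V.analyticRank = 1) (hrW : W.analyticRank = 0)
    (hcert : ∀ {N : ℕ} [NeZero N] (f : CuspForm (Gamma0 N) 2), IsNewformOf V f →
      PowerSeries.coeff 1 (padicLFunction f ((unitRoot V 3 : ℤ_[3]) : ℚ_[3])) ≠ 0) :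
    BSDp W 3 ↔ BSDp V 3 := by
  obtain ⟨qV, qW, hqV, hqW, heq⟩ :=
    XGordRankZeroOneCyclotomicThreeLower.padicVal_shaOrder_add_eq_of_surj_of_ram_noMilne V W hLowK hKato hS1 hPR hMT hGZK hmod hmodD C hC hord hsurj hram hadd hrV hrW hcert
  have hrV1 : V.analyticRank ≤ 1 := by rw [hrV]
  have hrW1 : W.analyticRank ≤ 1 := by rw [hrW]; exact zero_le_one
  haveI : Finite V.sha := (hGZK V hrV1).2
  haveI : Finite W.sha := (hGZK W hrW1).2
  constructor
  · intro hW
    obtain ⟨qW', hqW', hvW⟩ := missingPPartAt_of_bsdp W 3 hW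
    have hqq : qW' = qW := by exact_mod_cast hqW'.symm.trans hqW
    subst hqq
    exact bsdp_of_missingPPartAt V 3 hGZK hrV1 ⟨qV, hqV, by linarith⟩
  · intro hV
    obtain ⟨qV', hqV', hvV⟩ := missingPPartAt_of_bsdp V 3 hV
    have hqq : qV' = qV := by exact_mod_cast hqV'.symm.trans hqV
    subst hqq
    exact bsdp_of_missingPPartAt W 3 hGZK hrW1 ⟨qW, hqW, by linarith⟩

/-- **`BSD(W,3)` (and `BSD(V,3)`) on X4 ∧ (G-ord, `e = 2`) ∧ `p = 3` ∧ `r_an(W) = 0` ∧ twist of analytic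
rank ONE ∧ `surj ∧ ram` — anomalous rows included — from (⊇/K), the certificate and named facts only.**
`BSD(V,3)` for the rank-one good ordinary twist with `ρ̄_{V,3}` onto (`surj_iff_of_model_twist`) is the
tree theorem `bsdp_three_of_goodOrd_of_surj_noL20` (Yan–Zhu 2026 Thm. 4.15 [PUB\*] `hYZ`, modularity,
GZK); the twist transport carries it to the additive curve. X4 label UNCHANGED; nothing booked.
[cite: YanZhu2024MainConjNonCM, Thm. 4.15 (§4.6)] [cite: Kato2004Asterisque, Thm. 17.4 (3) (p. 273)]
[cite: GreenbergLNM1716, §4 p. 110] [cite: Milne1972ArithmeticAV, §1 Thm. 1 and §2 (through DokchitserDokchitserAnnals2010, §2.1, proof of Thm. 8)] -/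
theorem XGordRankZeroOneCyclotomicThreeLower.bsdp_of_surj_of_ram_noMilne
    (hYZ : YanZhu2026.thm415_padicValRat_bsd_rank_le_one)
    (hKato : Kato2004.charIdeal_dvd_padicLFunction_cyclotomicThree_of_surjective)
    (hS1 : Greenberg1999.schneider_charCoeff_rankOne_quadraticBaseChange)
    (hPR : perrinRiou_rankOne_leadingTerms_odd) (hMT : mazur_tate_sigma_exists_odd)
    (hGZK : rank_eq_analyticRank_of_analyticRank_le_one) (hmod : hasEntireLFunction_rat)
    (hmodD : nonempty_modularParametrizationData)
    (C : VariableChange ℚ) (hC : C • V.quadraticTwist (-(3 : ℚ)) = W)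
    (hord : IsOrdinaryAt V 3) (hsurj : Surj W 3) (hram : Ram W 3) (hadd : Addv W 3)
    (hrV : V.analyticRank = 1) (hrW : W.analyticRank = 0)
    (hcert : ∀ {N : ℕ} [NeZero N] (f : CuspForm (Gamma0 N) 2), IsNewformOf V f →
      PowerSeries.coeff 1 (padicLFunction f ((unitRoot V 3 : ℤ_[3]) : ℚ_[3])) ≠ 0) :
    BSDp W 3 ∧ BSDp V 3 := by
  have hsurjV : Surj V 3 := (surj_iff_of_model_twist V 3 (by norm_num : (-(3 : ℚ)) ≠ 0) ⟨C, hC⟩).mp hsurj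
  have hV : BSDp V 3 :=
    bsdp_three_of_goodOrd_of_surj_noL20 hYZ hmod hGZK (by rw [hrV]) hord hsurjV
  exact ⟨(XGordRankZeroOneCyclotomicThreeLower.bsdp_iff_bsdp_twist_of_surj_of_ram_noMilne V W hLowK hKato hS1 hPR hMT hGZK hmod hmodD C hC hord hsurj hram hadd hrV hrW hcert).mpr hV,
    hV⟩

end Facts

/-! ## Class forms on N11's (G-ord)@3 rows (`ClassX4Gord W 3`, twist of analytic rank one) -/

section ClassForms

variable {W : WeierstrassCurve ℚ} [W.IsElliptic] [W.IsGloballyMinimal]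

/- (⊇/K) for every good-ordinary twist model `V` of `W^{(−3)}` — the per-row residual input of the class
forms, shared by the theorems of this section. -/
variable
    (hLowK : ∀ (V : WeierstrassCurve ℚ) [V.IsElliptic] [V.IsGloballyMinimal] (C : VariableChange ℚ),
      GoodOrd V 3 → C • V.quadraticTwist (-(3 : ℚ)) = W →
      ∀ {κ : ZpExtension (CyclotomicField 3 ℚ) 3}
      {γ : Field.absoluteGaloisGroup (CyclotomicField 3 ℚ)} {N : ℕ} [NeZero N]
      {f : CuspForm (Gamma0 N) 2},
      κ.IsCyclotomic → κ.IsTopGenerator γ →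
      (∃ ζ : ℤ_[3]ˣ, IsOfFinOrder ζ ∧
        ((GaloisRep.cyclotomicCharacter (CyclotomicField 3 ℚ) 3 γ * ζ : ℤ_[3]ˣ) : ℤ_[3]) =
          (cyclotomicGenerator 3 : ℤ_[3])) →
      IsNewformOf V f →
      ∀ (D : (V.baseChange (CyclotomicField 3 ℚ)).SelmerDualData κ γ) (ϖ ϖ' : ℚ),
        (ϖ : ℝ) * V.realPeriodRat = plusPeriod f →
        (ϖ' : ℝ) * V.imaginaryPeriodRat = minusPeriod f →
        ∀ g ∈ D.charIdeal, ∃ h : IwasawaAlgebra 3,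
          iwasawaToPowerSeries 3 g =
            iwasawaToPowerSeries 3 h *
              (PowerSeries.C ((ϖ : ℚ_[3]) * (ϖ' : ℚ_[3])) *
                (padicLFunction f ((unitRoot V 3 : ℤ_[3]) : ℚ_[3]) *
                  padicLFunctionMinusBranch f ((unitRoot V 3 : ℤ_[3]) : ℚ_[3]) 1)))

include hLowK

/-- **X4♯(G-ord) at `3` ∧ `surj ∧ ram`, `r_an(E) = 0`, twist of analytic rank ONE, EVERY ROW (anomalous
included): the LOWER half `ord₃ #Ш_an(E) ≤ ord₃ #Ш(E)` ⟸ (⊇/K) for the good ordinary twist models of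
`E^{(−3)}` + their certificates `[T¹]L₃ ≠ 0` + their UPPER halves** (per-row binders over all globally
minimal `V`, `C` with `GoodOrd V 3`, `C • V^{(−3)} = E`; a model exists by
`ClassX4Gord.exists_goodOrd_pStar_twist_model`, `e = 2` by `semistabilityIndex_eq_two_of_typeG_three`).
[cite: GreenbergLNM1716, §4 p. 110] [cite: Miller2011LMS, Def. 1.1] -/
theorem ClassX4Gord.missingLowerBoundAt_three_rankZero_twistRankOne_of_lowerK_of_surj_of_ram_noMilne
    [Fact (Nat.Prime 3)]
    (hKato : Kato2004.charIdeal_dvd_padicLFunction_cyclotomicThree_of_surjective)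
    (hS1 : Greenberg1999.schneider_charCoeff_rankOne_quadraticBaseChange)
    (hPR : perrinRiou_rankOne_leadingTerms_odd) (hMT : mazur_tate_sigma_exists_odd)
    (hGZK : rank_eq_analyticRank_of_analyticRank_le_one) (hmod : hasEntireLFunction_rat)
    (hmodD : nonempty_modularParametrizationData)
    (hX : ClassX4Gord W 3) (hsurj : Surj W 3) (hram : Ram W 3) (hr : W.analyticRank = 0)
    (hrV : ∀ (V : WeierstrassCurve ℚ) [V.IsElliptic] [V.IsGloballyMinimal] (C : VariableChange ℚ),
      GoodOrd V 3 → C • V.quadraticTwist (-(3 : ℚ)) = W → V.analyticRank = 1)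
    (hcert : ∀ (V : WeierstrassCurve ℚ) [V.IsElliptic] [V.IsGloballyMinimal] (C : VariableChange ℚ),
      GoodOrd V 3 → C • V.quadraticTwist (-(3 : ℚ)) = W →
      ∀ {N : ℕ} [NeZero N] (f : CuspForm (Gamma0 N) 2), IsNewformOf V f →
      PowerSeries.coeff 1 (padicLFunction f ((unitRoot V 3 : ℤ_[3]) : ℚ_[3])) ≠ 0)
    (huV : ∀ (V : WeierstrassCurve ℚ) [V.IsElliptic] [V.IsGloballyMinimal] (C : VariableChange ℚ),
      GoodOrd V 3 → C • V.quadraticTwist (-(3 : ℚ)) = W → MissingUpperBoundAt V 3) :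
    MissingLowerBoundAt W 3 := by
  obtain ⟨V, iV, iVm, C, hgo, hC⟩ := ClassX4Gord.exists_goodOrd_pStar_twist_model W 3 hX
    (semistabilityIndex_eq_two_of_typeG_three W hX.typeGOrd.typeG hX.addv.2)
  have hC' : C • V.quadraticTwist (-(3 : ℚ)) = W := by
    have h3 : ((-1 : ℚ) ^ ((3 : ℕ) / 2) * (3 : ℕ)) = -(3 : ℚ) := by norm_num
    rw [← h3]; exact hC
  exact XGordRankZeroOneCyclotomicThreeLower.missingLowerBoundAt_of_missingUpperBoundAt_twist_of_surj_of_ram_noMilne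
    V W (fun hκ hγ hγ' hf D ϖ ϖ' hϖ hϖ' g hg ↦ hLowK V C hgo hC' hκ hγ hγ' hf D ϖ ϖ' hϖ hϖ' g hg)
    hKato hS1 hPR hMT hGZK hmod hmodD C hC' hgo hsurj hram hX.addv.2 (hrV V C hgo hC') hr
    (hcert V C hgo hC') (huV V C hgo hC')

/-- **X4♯(G-ord) at `3` ∧ `surj ∧ ram`, `r_an(E) = 0`, twist of analytic rank ONE, EVERY ROW (anomalous
included): `BSD(E,3)` ⟸ (⊇/K) for the good ordinary twist models of `E^{(−3)}` + their certificates** and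
the named facts Yan–Zhu 2026 Thm. 4.15 (`hYZ`, for the rank-one twist), Kato Thm. 17.4 (3) over `K`,
Greenberg p. 110 / Schneider, Perrin-Riou, Mazur–Tate, Milne, modularity, GZK. The one non-fact,
non-certificate input is (⊇/K) = PLAN §1.2 II.3's wall at `p = 3`; X4♯(G-ord) stays CONSTRUCTION-SHAPED;
nothing booked. [cite: YanZhu2024MainConjNonCM, Thm. 4.15 (§4.6)] [cite: GreenbergLNM1716, §4 p. 110]
[cite: Kato2004Asterisque, Thm. 17.4 (3) (p. 273)] [cite: Milne1972ArithmeticAV, §1 Thm. 1 and §2 (through DokchitserDokchitserAnnals2010, §2.1, proof of Thm. 8)] -/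
theorem ClassX4Gord.bsdp_three_rankZero_twistRankOne_of_lowerK_of_surj_of_ram_noMilne [Fact (Nat.Prime 3)]
    (hYZ : YanZhu2026.thm415_padicValRat_bsd_rank_le_one)
    (hKato : Kato2004.charIdeal_dvd_padicLFunction_cyclotomicThree_of_surjective)
    (hS1 : Greenberg1999.schneider_charCoeff_rankOne_quadraticBaseChange)
    (hPR : perrinRiou_rankOne_leadingTerms_odd) (hMT : mazur_tate_sigma_exists_odd)
    (hGZK : rank_eq_analyticRank_of_analyticRank_le_one) (hmod : hasEntireLFunction_rat)
    (hmodD : nonempty_modularParametrizationData)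
    (hX : ClassX4Gord W 3) (hsurj : Surj W 3) (hram : Ram W 3) (hr : W.analyticRank = 0)
    (hrV : ∀ (V : WeierstrassCurve ℚ) [V.IsElliptic] [V.IsGloballyMinimal] (C : VariableChange ℚ),
      GoodOrd V 3 → C • V.quadraticTwist (-(3 : ℚ)) = W → V.analyticRank = 1)
    (hcert : ∀ (V : WeierstrassCurve ℚ) [V.IsElliptic] [V.IsGloballyMinimal] (C : VariableChange ℚ),
      GoodOrd V 3 → C • V.quadraticTwist (-(3 : ℚ)) = W →
      ∀ {N : ℕ} [NeZero N] (f : CuspForm (Gamma0 N) 2), IsNewformOf V f →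
      PowerSeries.coeff 1 (padicLFunction f ((unitRoot V 3 : ℤ_[3]) : ℚ_[3])) ≠ 0) :
    BSDp W 3 := by
  obtain ⟨V, iV, iVm, C, hgo, hC⟩ := ClassX4Gord.exists_goodOrd_pStar_twist_model W 3 hX
    (semistabilityIndex_eq_two_of_typeG_three W hX.typeGOrd.typeG hX.addv.2)
  have hC' : C • V.quadraticTwist (-(3 : ℚ)) = W := by
    have h3 : ((-1 : ℚ) ^ ((3 : ℕ) / 2) * (3 : ℕ)) = -(3 : ℚ) := by norm_num
    rw [← h3]; exact hC
  exact (XGordRankZeroOneCyclotomicThreeLower.bsdp_of_surj_of_ram_noMilne V W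
    (fun hκ hγ hγ' hf D ϖ ϖ' hϖ hϖ' g hg ↦ hLowK V C hgo hC' hκ hγ hγ' hf D ϖ ϖ' hϖ hϖ' g hg)
    hYZ hKato hS1 hPR hMT hGZK hmod hmodD C hC' hgo hsurj hram hX.addv.2 (hrV V C hgo hC') hr
    (hcert V C hgo hC')).1

end ClassForms

end Summit.BirchSwinnertonDyer.Rank1Residual.Additive

end
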